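import Summits.ResolutionOfSingularities.ResolutionOfSingularities.Theorems.EquisingularLiftEquisingularLiftNatKummerHinges
import Mathlib.RingTheory.PowerSeries.Inverse
import HarnessLib

/-!
# The Eisenstein junction multisection (idea card `hilbert-burch-nose` / Q-ISO note of `res-L1-w45b-idea-1`; crux `EquisingularLift`,
# honest variant EL♮ = `EquisingularLiftNat`, stmt-ResolutionOfSingularities-20038): the SUPPORT statement
# `EisensteinMultisectionRegular` AS TYPED is refutable at the degenerate instance `f = 1`, and holds once `0 < deg f`

[OURS · L W4.5 (b)] Helper for `res-L1-w45b-idea-1`'s Sketch `HOME/L/res-L1-w45b-idea-1/Sketch-L1-idea-1.lean` v4 §6, `def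
EisensteinMultisectionRegular : Prop` («SUPPORT, known: Serre, *Local Fields* I §6 — the root ring of an Eisenstein polynomial over a
DVR is a DVR, totally ramified»). NOT a statement of the manuscript under review (Hironaka 2017); nothing here is attributed to its
author. Pure commutative algebra.

* `not_eisensteinMultisectionRegular` — the Prop AS TYPED (body VERBATIM, negated) is refutable: Mathlib's `Polynomial.IsEisensteinAt`
  does not require positive degree, so the constant polynomial `f = 1` over the DVR `ℚ⟦X⟧` is monic and (vacuously) Eisenstein at `𝔪`,
  while `AdjoinRoot 1` is the zero ring, which is not a (regular) local ring. CLASS: misstated (degenerate case); the card only ever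
  uses Eisenstein polynomials of degree `m ≥ 1` (`xᵐu + ϖψ`), so nothing in the card is affected.
* `eisensteinMultisectionRegular_of_natDegree_pos` — the evident repair (OURS: add `0 < f.natDegree`, exactly the extra hypothesis of
  Mathlib's `Polynomial.IsEisensteinAt.irreducible`): for a DVR `O` and a monic Eisenstein `f` of positive degree, `O[X]/(f)` is a
  regular local ring — indeed a local principal ideal domain: a domain by Eisenstein + Gauss; every maximal ideal contracts to `𝔪_O`,
  hence contains `x̄` (`x̄ⁿ ∈ 𝔪_O S` from the Eisenstein condition), hence equals `(x̄)` because `S/(x̄) ≅ O/(f(0)) = O/𝔪_O` (`f(0)` is a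
  uniformizer: `f(0) ∈ 𝔪 ∖ 𝔪²`); a Noetherian local domain with principal maximal ideal is a PID (abstract form
  `isLocalRing_and_isPrincipalIdealRing_of_pow_mem`, generalising `RamifiedCoalescence.isLocalRing_and_isPrincipalIdealRing_of_pow_eq`
  of p510448 from `x̄ᵉ = ϖ` to `x̄ᵉ ∈ 𝔪_O S`).

AI-written; AI review is weaker than expert review.
-/

set_option linter.dupNamespace false

noncomputable section

namespace Summit.ResolutionOfSingularities.ResolutionOfSingularities.Theorems.EquisingularLift.RegularModelCentres

open IsLocalRing Polynomial
open Summit.ResolutionOfSingularities.ResolutionOfSingularities.Theorems.EquisingularLift.RamifiedCoalescence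
  (exists_sub_algebraMap_mem_span_root)

/-- **`EisensteinMultisectionRegular` AS TYPED is refutable** (degenerate instance `f = 1` over `ℚ⟦X⟧`: monic, vacuously Eisenstein,
`AdjoinRoot 1 = 0` is not local). The negated body is the Sketch's `def EisensteinMultisectionRegular` VERBATIM. OURS. -/
theorem not_eisensteinMultisectionRegular :
    ¬ (∀ (O : Type) [CommRing O] [IsDomain O] [IsDiscreteValuationRing O] (f : Polynomial O),
        f.Monic → f.IsEisensteinAt (maximalIdeal O) → IsRegularLocalRing (AdjoinRoot f)) := by
  intro h
  have hm : maximalIdeal (PowerSeries ℚ) ≠ ⊤ := (maximalIdeal.isMaximal _).ne_top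
  have hE : (1 : Polynomial (PowerSeries ℚ)).IsEisensteinAt (maximalIdeal (PowerSeries ℚ)) :=
    { leading := by
        rw [Monic.leadingCoeff monic_one]
        exact fun h1 => hm ((Ideal.eq_top_iff_one _).mpr h1)
      mem := fun hn => absurd hn (by rw [natDegree_one]; exact Nat.not_lt_zero _)
      notMem := by
        rw [coeff_one_zero]
        exact fun h1 => hm ((Ideal.eq_top_iff_one _).mpr (Ideal.pow_le_self two_ne_zero h1)) }
  haveI := h (PowerSeries ℚ) 1 monic_one hE
  have h10 : (1 : AdjoinRoot (1 : Polynomial (PowerSeries ℚ))) = 0 := by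
    rw [← map_one (AdjoinRoot.mk (1 : Polynomial (PowerSeries ℚ))), AdjoinRoot.mk_self]
  exact one_ne_zero h10

/-- **Abstract Eisenstein root ring.** `O` local with maximal ideal `(ϖ)`; `S` a Noetherian domain, integral over `O`, with an element
`x` such that some power `xᵉ` lies in `𝔪_O S`, `ϖ ∈ xS`, and every element of `S` is congruent to a scalar modulo `x`. Then `S` is local
with maximal ideal `(x)` and a principal ideal ring. OURS (generalises `isLocalRing_and_isPrincipalIdealRing_of_pow_eq`, p510448). -/
theorem isLocalRing_and_isPrincipalIdealRing_of_pow_mem {O S : Type*} [CommRing O] [IsLocalRing O] [CommRing S] [IsDomain S]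
    [IsNoetherianRing S] [Algebra O S] [Algebra.IsIntegral O S] {ϖ : O} (hmO : maximalIdeal O = Ideal.span {ϖ})
    {x : S} {e : ℕ} (hxe : x ^ e ∈ (maximalIdeal O).map (algebraMap O S)) (hϖx : algebraMap O S ϖ ∈ Ideal.span {x})
    (hmod : ∀ s : S, ∃ a : O, s - algebraMap O S a ∈ Ideal.span {x}) :
    IsLocalRing S ∧ IsPrincipalIdealRing S := by
  -- every maximal ideal of `S` contains `x`
  have hxN : ∀ N : Ideal S, N.IsMaximal → x ∈ N := by
    intro N hN
    have hcomap : N.comap (algebraMap O S) = maximalIdeal O :=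
      IsLocalRing.eq_maximalIdeal (Ideal.isMaximal_comap_of_isIntegral_of_isMaximal N)
    have hle : (maximalIdeal O).map (algebraMap O S) ≤ N := by
      rw [Ideal.map_le_iff_le_comap, hcomap]
    exact hN.isPrime.mem_of_pow_mem e (hle hxe)
  have hxu : ¬ IsUnit x := by
    intro hu
    obtain ⟨N, hN⟩ := Ideal.exists_maximal S
    exact hN.ne_top (Ideal.eq_top_of_isUnit_mem N (hxN N hN) hu)
  -- `S/(x)` is a quotient of `O` with kernel `𝔪_O`: the residue field
  let π : O →+* S ⧸ Ideal.span {x} := (Ideal.Quotient.mk (Ideal.span {x})).comp (algebraMap O S)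
  have hπsurj : Function.Surjective π := by
    intro z
    obtain ⟨s, rfl⟩ := Ideal.Quotient.mk_surjective z
    obtain ⟨a, ha⟩ := hmod s
    exact ⟨a, (Ideal.Quotient.eq.mpr ha).symm⟩
  have hker : RingHom.ker π = maximalIdeal O := by
    apply le_antisymm
    · intro a ha
      by_contra hna
      have hau : IsUnit a := IsLocalRing.notMem_maximalIdeal.mp hna
      rw [RingHom.mem_ker] at ha
      have ha' : algebraMap O S a ∈ Ideal.span {x} := by
        simpa only [π, RingHom.comp_apply, Ideal.Quotient.eq_zero_iff_mem] using ha
      exact hxu (isUnit_of_dvd_unit (Ideal.mem_span_singleton.mp ha') (hau.map _))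
    · rw [hmO, Ideal.span_singleton_le_iff_mem, RingHom.mem_ker]
      simpa only [π, RingHom.comp_apply, Ideal.Quotient.eq_zero_iff_mem] using hϖx
  have hM : (Ideal.span {x} : Ideal S).IsMaximal := by
    apply Ideal.Quotient.maximal_of_isField
    have eqv : O ⧸ maximalIdeal O ≃+* S ⧸ Ideal.span {x} :=
      (Ideal.quotEquivOfEq hker.symm).trans (RingHom.quotientKerEquivOfSurjective hπsurj)
    have hF : IsField (O ⧸ maximalIdeal O) :=
      (Ideal.Quotient.maximal_ideal_iff_isField_quotient _).mp inferInstance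
    exact MulEquiv.isField hF eqv.symm.toMulEquiv
  have huniq : ∀ N : Ideal S, N.IsMaximal → N = Ideal.span {x} := fun N hN =>
    (hM.eq_of_le hN.ne_top ((Ideal.span_singleton_le_iff_mem _).mpr (hxN N hN))).symm
  haveI hloc : IsLocalRing S := IsLocalRing.of_unique_max_ideal ⟨Ideal.span {x}, hM, huniq⟩
  refine ⟨hloc, ?_⟩
  have hmS : maximalIdeal S = Ideal.span {x} := (IsLocalRing.eq_maximalIdeal hM).symm
  have hprinc : (maximalIdeal S).IsPrincipal := ⟨⟨x, by rw [hmS]⟩⟩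
  exact ((tfae_of_isNoetherianRing_of_isLocalRing_of_isDomain S).out 4 0).mp hprinc

-- Mathlib's `IsDiscreteValuationRing O` takes `[IsDomain O]` as a parameter, so the `overlappingInstances` lint (both imply
-- `Nontrivial`) is unavoidable for a DVR binder; silenced per statement (as in the Sketches).
set_option linter.overlappingInstances false in
/-- In a DVR, an element of `𝔪 ∖ 𝔪²` generates `𝔪`. OURS. -/
theorem maximalIdeal_eq_span_of_not_mem_sq {O : Type*} [CommRing O] [IsDomain O] [IsDiscreteValuationRing O] {a : O}
    (ha : a ∈ maximalIdeal O) (ha2 : a ∉ maximalIdeal O ^ 2) : maximalIdeal O = Ideal.span {a} := by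
  obtain ⟨π, hπ⟩ := IsDiscreteValuationRing.exists_irreducible O
  have hm : maximalIdeal O = Ideal.span {π} := (IsDiscreteValuationRing.irreducible_iff_uniformizer π).mp hπ
  rw [hm] at ha ha2 ⊢
  obtain ⟨b, rfl⟩ := Ideal.mem_span_singleton'.mp ha
  have hb : IsUnit b := by
    by_contra hb
    have hbm : b ∈ Ideal.span {π} := by
      rw [← hm]; exact (IsLocalRing.mem_maximalIdeal _).mpr hb
    exact ha2 (by rw [pow_two]; exact Ideal.mul_mem_mul hbm (Ideal.mem_span_singleton_self π))
  rw [Ideal.span_singleton_mul_left_unit hb]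

set_option linter.overlappingInstances false in
/-- **Repaired statement (OURS): the root ring of a monic Eisenstein polynomial of POSITIVE degree over a DVR is a regular local
ring** (indeed a local PID; Serre, *Local Fields* I §6 — here via the abstract `isLocalRing_and_isPrincipalIdealRing_of_pow_mem`). -/
theorem eisensteinMultisectionRegular_of_natDegree_pos :
    ∀ (O : Type) [CommRing O] [IsDomain O] [IsDiscreteValuationRing O] (f : Polynomial O),
      f.Monic → 0 < f.natDegree → f.IsEisensteinAt (maximalIdeal O) → IsRegularLocalRing (AdjoinRoot f) := by
  intro O _ _ _ f hfm hdeg hE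
  -- `f` is prime (Eisenstein + Gauss), so `S = O[X]/(f)` is a domain, finite over `O`
  have hirr : Irreducible f := hE.irreducible inferInstance hfm.isPrimitive hdeg
  haveI hS : IsDomain (AdjoinRoot f) := AdjoinRoot.isDomain_of_prime hirr.prime
  haveI : Module.Finite O (AdjoinRoot f) := hfm.finite_adjoinRoot
  haveI : Algebra.IsIntegral O (AdjoinRoot f) := Algebra.IsIntegral.of_finite O _
  -- `f(0)` is a uniformizer
  have hc0 : f.coeff 0 ∈ maximalIdeal O := hE.mem hdeg
  have hmO : maximalIdeal O = Ideal.span {f.coeff 0} := maximalIdeal_eq_span_of_not_mem_sq hc0 hE.notMem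
  -- `x̄ⁿ ∈ 𝔪_O S` (Eisenstein) and `f(0) ∈ (x̄)` (from `f = X·(f div X) + f(0)`)
  set x : AdjoinRoot f := AdjoinRoot.root f with hx
  have h0 : aeval x f = 0 := by rw [hx, AdjoinRoot.aeval_eq, AdjoinRoot.mk_self]
  have hxe : x ^ f.natDegree ∈ (maximalIdeal O).map (algebraMap O (AdjoinRoot f)) := by
    have h1 := congrArg (aeval x) hfm.as_sum
    rw [h0, map_add, map_pow, aeval_X, map_sum] at h1
    have hsum : ∑ i ∈ Finset.range f.natDegree, aeval x (C (f.coeff i) * X ^ i) ∈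
        (maximalIdeal O).map (algebraMap O (AdjoinRoot f)) := by
      refine Ideal.sum_mem _ fun i hi => ?_
      rw [map_mul, map_pow, aeval_X, aeval_C]
      exact Ideal.mul_mem_right _ _ (Ideal.mem_map_of_mem _ (hE.mem (Finset.mem_range.mp hi)))
    have : x ^ f.natDegree = -∑ i ∈ Finset.range f.natDegree, aeval x (C (f.coeff i) * X ^ i) :=
      eq_neg_of_add_eq_zero_left h1.symm
    rw [this]
    exact ((maximalIdeal O).map (algebraMap O (AdjoinRoot f))).neg_mem hsum
  have hϖx : algebraMap O (AdjoinRoot f) (f.coeff 0) ∈ Ideal.span {x} := by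
    have h1 := congrArg (aeval x) (X_mul_divX_add f)
    rw [h0, map_add, map_mul, aeval_X, aeval_C] at h1
    have : algebraMap O (AdjoinRoot f) (f.coeff 0) = -(x * aeval x f.divX) := eq_neg_of_add_eq_zero_right h1
    rw [this]
    exact (Ideal.span {x}).neg_mem (Ideal.mul_mem_right _ _ (Ideal.mem_span_singleton_self x))
  obtain ⟨hloc, hpir⟩ := isLocalRing_and_isPrincipalIdealRing_of_pow_mem hmO hxe hϖx
    (exists_sub_algebraMap_mem_span_root f)
  haveI := hloc
  haveI := hpir
  infer_instance

end Summit.ResolutionOfSingularities.ResolutionOfSingularities.Theorems.EquisingularLift.RegularModelCentres
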